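import Mathlib
import HarnessLib
import HarnessLib.Audit
import Summits.NavierStokesRegularity.Statement
import Literature.Analysis.FluidPDE.KatoMaximalTime
import Literature.Analysis.FluidPDE.SelfSimilar
import Literature.Analysis.FluidPDE.SuitableWeak
import Literature.Analysis.FluidPDE.WeakSolution
import Literature.Analysis.FluidPDE.ClassicalSolution
import Literature.Analysis.FluidPDE.VectorCalculus
import Literature.Analysis.FluidPDE.MildSolution
import Literature.Analysis.FluidPDE.LerayHopf
import Literature.Analysis.FluidPDE.NSWave0
import HarnessLib.Audit.Status.Attr

/-!
Route: AmplitudeIndex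

DORMANT since 2026-09-01T08:52:43Z (reconciler: no traction for 5 d (last activity statement-checked at 2026-08-27T08:09:21Z); parked, not closed — `ledger route dormant route-NavierStokesRegularity-AmplitudeIndex --off` to reactivate) — unstaffed, not closed; items shared with open routes are served there. `ledger route dormant <id> --off` reactivates.

# Route AmplitudeIndex — Enstrophy index in Leray variables: a threshold affords one instability,
its amplitude; enstrophy-stable Type-I tangent flows are trivial

X = T ∧ S ∧ M ("it suffices to show"), realising idea card simons-cone-amplitude-threshold-index
(Simons' cone for Navier–Stokes) in a REPAIRED FRAME: the second variation is taken for the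
VORTICITY of perturbations in FLAT L²(dy) of backward similarity variables y = x/√(T−t), s =
−log(T−t), ν = 1 (U = in-tree `lerayOrbit v`; rev 2 writes it out as U(s,y) = e^(−s/2) v(−e^(−s),
e^(−s/2) y) inside the items so that the route's cone stays in proved files), where ⟨(Δ − ½y·∇ −
1)ω, ω⟩ = −‖∇ω‖² − ¼‖ω‖² is coercive (for velocity, or with the card's Gaussian weight, it is not —
see Why this line); ∫|Ω(s,y)|²dy = √(T−t)·(enstrophy at time t), so the quadratic form B_s is the
second variation of the LERAY-NORMALISED ENSTROPHY. Perturbations are parametrised by test velocity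
fields w (ω = curl w, so no Biot–Savart or pressure appears and every integrand is compactly
supported): P_s(w,w′) = ∫(−∇curl w:∇curl w′ − ¼ curl w·curl w′ + (U×curl w + w×curl U)·curl curl
w′)dy = ⟨A_s curl w, curl w′⟩ for the in-tree linearised vorticity operator A_s ω = (Δ − ½y·∇ − 1)ω
+ curl(U×ω + w×Ω); B_s = its symmetrisation. Symmetry/amplitude directions at time s (velocity
shapes, one ten-parameter family): DU(s)[a + σy + Ay] + (σ+τ)U(s) − AU(s) + ρ∂_sU(s), a ∈ ℝ³, σ, τ,
ρ ∈ ℝ, A skew (translations, time shift U + y·∇U, amplitude U, rotations, scaling ∂_sU).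
"Enstrophy-stable" = P_s(w,w) ≤ 0 for every s and every C_c^∞ div-free w that is B_s-orthogonal to
the whole family.
T (ThresholdEnstrophyStable, rank 2): a Clay datum at its CRITICAL VISCOSITY (global Kato solutions
for all ν' > ν, none at ν — = amplitude threshold A_c = 1 on the ray A•u₀ by the in-tree
hasGlobalKatoSolution_smul_iff) whose Kato solutions are scaled-L³ Type I (the conclusion of M)
admits a member v of the tangent-flow class 𝒯 (ancient mild ν=1, C^∞ on t<0, |v| ≤ C/√(−t): a smooth
BOUNDED ENTIRE ORBIT of the profile semiflow; intended witness: a ν-normalised blow-up limit at a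
singular point) which is enstrophy-stable and has nonvanishing vorticity.
S (StableTangentFlowLiouville, rank 3; "Bernstein theorem"): every enstrophy-stable v ∈ 𝒯 is
irrotational (curl v ≡ 0; with |v| ≤ C/√(−t) this leaves only the parasitic x-independent b(t),
which the duality-form mild class does not exclude and which T's witness is not).
M (MarginalBlowupTypeI, rank 4) = route MarginalTypeI's crux stmt-NavierStokesRegularity-1748
verbatim (shared): at the critical viscosity every Kato solution is locally scaled-L³ Type I.
Lean: `(∀ ν : ℝ, 0 < ν → ∀ u₀ : EuclideanSpace ℝ (Fin 3) → EuclideanSpace ℝ (Fin 3), ContDiff ℝ (⊤ :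
ℕ∞) u₀ → Literature.Analysis.FluidPDE.NSWave0.IsDivFree u₀ →
Literature.Analysis.FluidPDE.HasRapidSpatialDecay u₀ → (∀ ν' : ℝ, ν < ν' →
Literature.Analysis.FluidPDE.HasGlobalKatoSolution ν' u₀) → ¬
Literature.Analysis.FluidPDE.HasGlobalKatoSolution ν u₀ → (∀ (T : ℝ) (u : ℝ → EuclideanSpace ℝ (Fin
3) → EuclideanSpace ℝ (Fin 3)), 0 < T → Literature.Analysis.FluidPDE.IsKatoSolutionOn T ν u₀ u → ∀
x₀ : EuclideanSpace ℝ (Fin 3), ∃ r₀ : ℝ, 0 < r₀ ∧ (⨆ (r : ℝ) (_ : 0 < r) (z : ℝ × EuclideanSpace ℝ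
(Fin 3)) (_ : Literature.Analysis.FluidPDE.parabolicCylinder r z ⊆
Literature.Analysis.FluidPDE.parabolicCylinder r₀ (T, x₀)), Literature.Analysis.FluidPDE.cknC r z u)
< ⊤) → ∃ v : ℝ → EuclideanSpace ℝ (Fin 3) → EuclideanSpace ℝ (Fin 3),
Literature.Analysis.FluidPDE.IsAncientMildSolution 1 v ∧ ContDiffOn ℝ (⊤ : ℕ∞) (Function.uncurry v)
(Set.Iio 0 ×ˢ Set.univ) ∧ (∃ C : ℝ, Literature.Analysis.FluidPDE.HasTypeITimeDecay C v) ∧ (let curl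
:= Literature.Analysis.FluidPDE.curl; let cross := Literature.Analysis.FluidPDE.cross; let U := fun
(s : ℝ) (y : EuclideanSpace ℝ (Fin 3)) => Real.exp (-s / 2) • v (-Real.exp (-s)) (Real.exp (-s / 2)
• y); let P := fun s w w' => ∫ y, (-(∑ i : Fin 3, inner ℝ (fderiv ℝ (curl w) y
(EuclideanSpace.single i (1 : ℝ))) (fderiv ℝ (curl w') y (EuclideanSpace.single i (1 : ℝ)))) - (1 /
4 : ℝ) * inner ℝ (curl w y) (curl w' y) + inner ℝ (cross (U s y) (curl w y) + cross (w y) (curl (U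
s) y)) (curl (curl w') y)); let B := fun s w w' => P s w w' + P s w' w; ∀ s w, ContDiff ℝ (⊤ : ℕ∞) w
→ HasCompactSupport w → Literature.Analysis.FluidPDE.VectorCalculus.IsDivFree w → (∀ a (σ τ ρ : ℝ),
∀ A ∈ skewAdjoint (EuclideanSpace ℝ (Fin 3) →L[ℝ] EuclideanSpace ℝ (Fin 3)), B s w (fun y => fderiv
ℝ (U s) y (a + σ • y + A y) + (σ + τ) • U s y - A (U s y) + ρ •
Literature.Analysis.FluidPDE.timeDeriv U s y) = 0) → P s w w ≤ 0) ∧ ∃ t < 0, ∃ x,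
Literature.Analysis.FluidPDE.curl (v t) x ≠ 0) ∧ (∀ v : ℝ → EuclideanSpace ℝ (Fin 3) →
EuclideanSpace ℝ (Fin 3), Literature.Analysis.FluidPDE.IsAncientMildSolution 1 v → ContDiffOn ℝ (⊤ :
ℕ∞) (Function.uncurry v) (Set.Iio 0 ×ˢ Set.univ) → (∃ C : ℝ,
Literature.Analysis.FluidPDE.HasTypeITimeDecay C v) → (let curl :=
Literature.Analysis.FluidPDE.curl; let cross := Literature.Analysis.FluidPDE.cross; let U := fun (s
: ℝ) (y : EuclideanSpace ℝ (Fin 3)) => Real.exp (-s / 2) • v (-Real.exp (-s)) (Real.exp (-s / 2) •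
y); let P := fun s w w' => ∫ y, (-(∑ i : Fin 3, inner ℝ (fderiv ℝ (curl w) y (EuclideanSpace.single
i (1 : ℝ))) (fderiv ℝ (curl w') y (EuclideanSpace.single i (1 : ℝ)))) - (1 / 4 : ℝ) * inner ℝ (curl
w y) (curl w' y) + inner ℝ (cross (U s y) (curl w y) + cross (w y) (curl (U s) y)) (curl (curl w')
y)); let B := fun s w w' => P s w w' + P s w' w; ∀ s w, ContDiff ℝ (⊤ : ℕ∞) w → HasCompactSupport w
→ Literature.Analysis.FluidPDE.VectorCalculus.IsDivFree w → (∀ a (σ τ ρ : ℝ), ∀ A ∈ skewAdjoint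
(EuclideanSpace ℝ (Fin 3) →L[ℝ] EuclideanSpace ℝ (Fin 3)), B s w (fun y => fderiv ℝ (U s) y (a + σ •
y + A y) + (σ + τ) • U s y - A (U s y) + ρ • Literature.Analysis.FluidPDE.timeDeriv U s y) = 0) → P
s w w ≤ 0) → ∀ t < 0, ∀ x, Literature.Analysis.FluidPDE.curl (v t) x = 0) ∧ (∀ ν : ℝ, 0 < ν → ∀ u₀ :
EuclideanSpace ℝ (Fin 3) → EuclideanSpace ℝ (Fin 3), ContDiff ℝ (⊤ : ℕ∞) u₀ →
Literature.Analysis.FluidPDE.NSWave0.IsDivFree u₀ →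
Literature.Analysis.FluidPDE.HasRapidSpatialDecay u₀ → (∀ ν' : ℝ, ν < ν' →
Literature.Analysis.FluidPDE.HasGlobalKatoSolution ν' u₀) → ¬
Literature.Analysis.FluidPDE.HasGlobalKatoSolution ν u₀ → ∀ (T : ℝ) (u : ℝ → EuclideanSpace ℝ (Fin
3) → EuclideanSpace ℝ (Fin 3)), 0 < T → Literature.Analysis.FluidPDE.IsKatoSolutionOn T ν u₀ u → ∀
x₀ : EuclideanSpace ℝ (Fin 3), ∃ r₀ : ℝ, 0 < r₀ ∧ (⨆ (r : ℝ) (_ : 0 < r) (z : ℝ × EuclideanSpace ℝ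
(Fin 3)) (_ : Literature.Analysis.FluidPDE.parabolicCylinder r z ⊆
Literature.Analysis.FluidPDE.parabolicCylinder r₀ (T, x₀)), Literature.Analysis.FluidPDE.cknC r z u)
< ⊤)`

## Assembly
Deciding theorem `closes` (rev 2; certified sorry-free by the gate's native check, axioms
propext/Classical.choice/Quot.sound): ThresholdEnstrophyStable → StableTangentFlowLiouville →
MarginalBlowupTypeI → GIPL3Stability → CriticalViscosityOfGIP → KatoToClay → NavierStokesRegularity.
Given ν > 0 and a Clay datum u₀: if HasGlobalKatoSolution ν u₀, KatoToClay (verbatim the PROVED tree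
fact Literature.Analysis.FluidPDE.clay_solution_of_hasGlobalKatoSolution, discharged in
NSKatoToClayHolds.lean; same signature as ThinOrFatPincer's stmt-NavierStokesRegularity-8948) yields
the Clay solution; otherwise CriticalViscosityOfGIP — fed by GIPL3Stability, which is the literature
fact GIP2003_L3_stability verbatim (the route's one piece of literature debt, needs-fact:
Literature.Analysis.FluidPDE.GIP2003_L3_stability) — moves the SAME datum to its critical viscosity
ν_c ≥ ν (no global Kato solution at ν_c, global for every ν' > ν_c); MarginalBlowupTypeI gives the
scaled Type-I bound at ν_c; ThresholdEnstrophyStable produces an enstrophy-stable v ∈ 𝒯 with curl v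
≢ 0; StableTangentFlowLiouville says curl v ≡ 0 — contradiction (ten tactic lines, planner's
glue.lean). AmplitudeMountainPass, FiniteEnstrophyIndex and LiouvilleImpliesStable are support
statements NOT used by `closes` (sanity anchors of the frame and the recorded implication (L) ⇒ S).
Rev 2 (route-repair 2026-08-15): T now carries the Clay hypotheses on u₀ that M carries (weaker
claim, same assembly); U = lerayOrbit v and (L) = LiouvilleConjectureNS are written out
definitionally (Iff.rfl) so that no cite-only conjecture and no unproved-fact host file
(SelfSimilarLiouville, HyperbolicDSSOrbit, Vorticity) sits in the cone; the shared
CriticalViscosityExists (stmt-NavierStokesRegularity-1750, stays with MarginalTypeI) is replaced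
here by CriticalViscosityOfGIP := GIPL3Stability → (its text); the Assembly item is restated by decl
names over the same six hypotheses (its proof is `exact closes`).

Rationale: WHY THIS LINE. Mechanism (card): every nontrivial profile is energy-UNSTABLE along its own amplitude
— for a steady profile the linearisation A_U satisfies A_U Ω = −(Δ − ½y·∇ − 1)Ω, so B(U,U) = ‖∇Ω‖² +
¼‖Ω‖² > 0 (= the stretching production ∫Ω·(∇U)Ω, HubbleDynamo's DilutionBudget identity), and along
any orbit ∫B_s(U,U)ds = [‖Ω‖²] + ∫(‖∇Ω‖² + ¼‖Ω‖²) (support AmplitudeMountainPass) — while a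
THRESHOLD solution, being a codimension-one limit of global solutions (GallagherIftimiePlanchon2003
Thm 3.1–3.2; MatanoMerle2011 for the heat-equation model; threshold = centre-stable manifold in
critical dispersive problems), should afford exactly one instability; if that one is spent on the
amplitude, the tangent flow is STABLE off the symmetry span and a stability-inequality Liouville
theorem (Simons1968 cones-are-unstable ⇒ Bernstein; SchoenSimonYau1975 curvature estimates by
inserting derived fields into the stability inequality; ChodoshLi2021; ColdingMinicozzi2012's
entropy-index for shrinkers) should kill it. Imported: minimal-surface/MCF stability theory (second
variation, index, stable-Bernstein), threshold dynamics of critical PDE, classical energy-stability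
theory of fluid flows (Serrin1959; DoeringGibbon1995 §2.2 pp.31–33: the energy quadratic form and
its symmetric eigenproblem (2.2.20)–(2.2.25) — our B_s is that form for the profile flow in
similarity variables, with enstrophy as the energy).
Planner's repair of the card (recorded in Numbers): in the card's Gaussian frame H¹_σ(e^(−|y|²/4))
the energy index of EVERY nontrivial profile is infinite — far-field div-free bumps at |y| ~ R cost
e^(−R²/4) but couple to the core through the linearised pressure (∇π(0) ~ C₀R^(−5)), so the 2×2
blocks are indefinite; the same happens for vorticity in L²(γ) through Biot–Savart. In flat L² for
vorticity the far bumps cost ¼ and couple only like R^(−3) (Biot–Savart of a compactly supported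
div-free field), the zero flow is strictly stable, and the perturbation terms are form-compact
(decaying potential C₀/(1+|y|); ‖|Ω|·BS[ω]‖₂ ≲ ‖ω‖₂ by Hardy + Calderón–Zygmund, SteinWeiss1971) —
support FiniteEnstrophyIndex; this flat frame is the L²-adjoint twin of JiaSverak2015's
forward-variables operator (Δ + ½x·∇ + ½, spectrum in Re λ ≤ −¼, K_σ relatively compact,
arXiv:1306.2136 p.3). What the line does that prior routes do not: MarginalTypeI (same threshold
frame) closes with the structureless Liouville (L′) = stmt-1749; SymmetryModuliCount counts symmetry
Jacobi fields; HubbleDynamo works in the same Leray-vorticity variables but with the KINEMATIC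
operator (no Biot–Savart feedback; Ω is its neutral mode) and anti-dynamo bounds at small magnetic
Reynolds number; DssFarFieldSlaving ASSUMES Floquet hyperbolicity. Here the full self-consistent
second variation is the object, its sign off a ten-dimensional span is the hypothesis of the
Liouville theorem, and the threshold construction is what supplies that sign. Negatives index: empty
at filing.

RANKED CRUXES. #2 ThresholdEnstrophyStable (crux) — (T) THRESHOLD ⇒ INDEX ONE, REALISED BY THE
AMPLITUDE (card S1, repaired frame). For ν>0 and a datum u₀ at a critical viscosity —
HasGlobalKatoSolution ν' u₀ for all ν'>ν, ¬HasGlobalKatoSolution ν u₀ (for Clay data = amplitude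
threshold A_c = 1 on the ray A•u₀, hasGlobalKatoSolution_smul_iff) — whose Kato solutions obey the
local scaled-L³ Type-I bound (verbatim the conclusion of MarginalBlowupTypeI), there is v ∈ 𝒯
(IsAncientMildSolution 1 v; C^∞ on t<0; |v| ≤ C/√(−t), i.e. U = lerayOrbit v is a smooth bounded
entire orbit) which is ENSTROPHY-STABLE — for every s and every C_c^∞ div-free w with B_s(w,
DU(s)[a+σy+Ay] + (σ+τ)U(s) − AU(s) + ρ∂_sU(s)) = 0 for all a ∈ ℝ³, σ,τ,ρ ∈ ℝ, A ∈ so(3): P_s(w,w) ≤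
0, with P_s, B_s as in § Thesis — and has curl v ≢ 0. Intended (not encoded, for length): v is a
ν-normalised blow-up limit (c_k/ν)u(t_k + c_k²t/ν, x_k + c_kx) → v at a singular point of the
threshold Kato solution; that SOME blow-up sequence yields a smooth bounded entire orbit is part of
the claim and more than M's scaled-L³ Type I gives (automatic for DSS limits, ChaeWolf2017 Thm 1.1).
Equivalent reading: ind(B_s) = ind(B_s restricted to the ten-dimensional symmetry/amplitude span)
for every s — all positivity of the second variation of the Leray-normalised enstrophy is symmetry
or amplitude. [deps: MarginalBlowupTypeI] [difficulty: XL] (why it might fail: A_s is non-normal: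
one unstable Floquet multiplier mod symmetries need not give P_s ≤ 0 on a B-complement (transient
enstrophy growth, cf. Couette); pointwise-in-s stability may fail at some DSS phases; no blow-up
limit need be a bounded entire orbit (sup-rate Type I is more than M gives).)
[GallagherIftimiePlanchon2003, MatanoMerle2011, DoeringGibbon1995, JiaSverak2015, GuillodSverak2023,
AlbrittonBarker2019, ChaeWolf2017RemovingDSS, Tao2016AveragedNS]
#3 StableTangentFlowLiouville (crux) — (S) BERNSTEIN THEOREM FOR ENSTROPHY-STABLE TANGENT FLOWS
(card S2, repaired frame). Every v with IsAncientMildSolution 1 v, C^∞ on (−∞,0)×ℝ³ and |v(t,x)| ≤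
C/√(−t) which is enstrophy-stable in the sense of crux 2 (P_s(w,w) ≤ 0 for all s and all test w that
are B_s-orthogonal to the ten-parameter symmetry/amplitude family of U(s) = lerayOrbit v s) is
irrotational: curl v ≡ 0 on t<0 (the conclusion is stated on the vorticity so that the x-independent
parasitic solutions b(t) of the duality-form mild class, which are enstrophy-stable, are not
counterexamples; modulo them v ≡ 0). Steady profiles: vacuous by NRŠ1996/Tsai1998; λ-DSS with λ near
1: ChaeWolf2017 Thm 1.3; axisymmetric: SereginSverak2009; content = DSS with λ away from 1 and
recurrent/general bounded orbits — the STABLE sub-case of TypeIDSSLiouvilleConjecture / (L′),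
implied by (L) (support LiouvilleImpliesStable), strictly weaker than
stmt-NavierStokesRegularity-1749. Intended tool (Schoen–Simon–Yau): insert derived fields of U (curl
Ω, ΔΩ, strain eigenfields) as w into P_s ≤ 0 after B_s-projecting off the family and subtract the
identities they satisfy (first rungs on the card); the mountain-pass excess ‖∇Ω‖²+¼‖Ω‖² (support
AmplitudeMountainPass) is the quantity every such identity must beat. [difficulty: XL] (why it might
fail: No Simons-type identity with a SIGNED cubic term is known for NS profiles; cut-off errors for
|U| ≲ 1 bounded orbits are borderline (critical class); one Type-I DSS/recurrent ancient solution
that is enstrophy-stable off the ten directions refutes it (TypeIDSSLiouvilleConjecture is open).)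
[Simons1968, SchoenSimonYau1975, ChodoshLi2021, ColdingMinicozzi2012, NecasRuzickaSverak1996,
Tsai1998, ChaeWolf2017RemovingDSS, BradshawTsai2017CPDE, KNSS2009, SereginSverak2009]
#4 MarginalBlowupTypeI (crux) — (M) MARGINAL BLOW-UP IS TYPE I — verbatim route MarginalTypeI's crux
stmt-NavierStokesRegularity-1748 (shared item; card: "threshold singularities are Type I" =
threshold-marginal's (α)-branch): at the critical viscosity of a Clay datum every Kato solution u on
[0,T) has, at every x₀, an r₀>0 with sup over parabolic sub-balls Q_r(z) ⊆ Q_(r₀)(T,x₀) of cknC r z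
u = r⁻²∫∫|u|³ finite. [difficulty: XL] (why it might fail: A codimension-one Type-II mechanism could
sit on the boundary of the global set; Tao's averaged NS blows up at Type-II rate (arXiv:1402.0290
p.8), so no averaging-insensitive proof exists; free global families carry arbitrarily concentrated
bursts.) [MatanoMerle2011, Tao2016AveragedNS, GallagherIftimiePlanchon2003, Seregin2006,
AlbrittonBarker2019]
#9 CriticalViscosityOfGIP (support; rev 2, replaces in this route the shared
stmt-NavierStokesRegularity-1750, which stays with MarginalTypeI) — CRITICAL VISCOSITY FROM
L³-STABILITY: GIPL3Stability → (a Clay datum without global Kato solution at ν has a critical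
viscosity ν_c ≥ ν: no global Kato solution at ν_c, global for all ν' > ν_c). Proof (provable now): S
= {ν' ≥ ν : ¬HasGlobalKatoSolution ν' u₀} is bounded by small-data global existence at large
viscosity (fujita_kato_global_small_holds / kato_global_small with hasGlobalKatoSolution_smul_iff,
KatoViscosityScaling.lean) and ν_c = sup S is attained because the global set is open in ν' —
GIP2003_L3_stability.exists_ball_hasGlobalKatoSolution (GIPGlobalStability.lean, proved modulo the
fact) applied to the hypothesis. [difficulty: M] [GallagherIftimiePlanchon2003, RusinSverak2011,
Kato1984]
#9 GIPL3Stability (support; literature debt) — verbatim the named fact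
Literature.Analysis.FluidPDE.GIP2003_L3_stability (Gallagher–Iftimie–Planchon 2003, Thm 0.1, Thm
3.1–3.2; unit viscosity): a global Kato solution decays in L³ and L³-nearby weakly div-free data
have global Kato solutions with Lipschitz dependence. Closes by `exact GIP2003_L3_stability_holds`
once the fact is proved in Literature (needs-fact:
Literature.Analysis.FluidPDE.GIP2003_L3_stability); its host file is kept OUT of the route's
imports. [difficulty: L] [GallagherIftimiePlanchon2003]
#9 KatoToClay (support; rev 2) — KATO → CLAY bridge, verbatim the named fact
clay_solution_of_hasGlobalKatoSolution, PROVED in tree (NSKatoToClayHolds.lean: `exact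
Literature.Analysis.FluidPDE.clay_solution_of_hasGlobalKatoSolution_holds`); same signature as
ThinOrFatPincer stmt-NavierStokesRegularity-8948 / MinimalBlowupRigidity
stmt-NavierStokesRegularity-0108. [difficulty: provable-now] [Kato1984, LemarieRieusset2016]
#9 AmplitudeMountainPass (support) — (F1) EVERY ORBIT IS ENSTROPHY-UNSTABLE ALONG ITS OWN AMPLITUDE,
on average. For a classical NS solution (ν=1, zero force) on t<0 with the parabolic Type-I envelope
up to third derivatives (|∇ⁿv(t,x)| ≤ C/(|x|+√−t)^(n+1), n ≤ 3), the orbit U = lerayOrbit v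
satisfies for s₁ ≤ s₂: ∫_(s₁)^(s₂) P_s(U(s),U(s)) ds = ‖curl U(s₂)‖²₂ − ‖curl U(s₁)‖²₂ +
∫_(s₁)^(s₂)(‖∇curl U‖²₂ + ¼‖curl U‖²₂) ds. Proof: A_s Ω = 2∂_sΩ − (Δ − ½y·∇ − 1)Ω from the vorticity
equation in similarity variables, and ⟨(Δ − ½y·∇ − 1)Ω, Ω⟩ = −‖∇Ω‖² − ¼‖Ω‖² (drift contributes +¾,
scaling −1); steady case: P(U,U) = ‖∇Ω‖² + ¼‖Ω‖² > 0 unless Ω ≡ 0 (Simons' 'cones are unstable' with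
a one-line proof; sanity anchor of the frame). [difficulty: M] [DoeringGibbon1995,
ChaeWolf2017RemovingDSS, Simons1968]
#9 FiniteEnstrophyIndex (support) — (F2) FINITE ENSTROPHY INDEX OF A FROZEN TYPE-I PROFILE. For a
smooth field U on ℝ³ with |U| ≤ C/(1+|y|) and |curl U| ≤ C/(1+|y|)², there is N such that any family
of test velocity fields w₁..w_n (C_c^∞, div-free) on whose span the frozen quadratic form P(w,w)
(crux 2 with U(s) ≡ U) is positive definite has n ≤ N. Proof sketch: P(w,w) ≤ −½‖∇ω‖² − ¼‖ω‖² +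
K(ω), ω = curl w, where |∫(U×ω)·curl ω| ≤ ∫ C(1+|y|)⁻¹|ω||∇ω| (decaying potential) and ‖curl U · w‖₂
≤ C‖(1+|y|)⁻² BS[ω]‖₂ ≲ ‖ω‖₂ by Hardy's inequality and ‖∇BS[ω]‖₂ ≲ ‖ω‖₂ (SteinWeiss1971), both
form-compact relative to H¹ (Rellich locally, smallness at infinity) — the flat-vorticity analogue
of JiaSverak2015's relative compactness of K_σ; min–max. (In the Gaussian frame of the card this
statement is FALSE — see Numbers.) [difficulty: L] [JiaSverak2015, SteinWeiss1971,
DoeringGibbon1995, GallayWayne2005]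
#9 LiouvilleImpliesStable (support) — (L) ⇒ (S): KNSS's Liouville conjecture (L) (Literature's
LiouvilleConjectureNS written out verbatim — rev 2, so that the cite-only conjecture is a HYPOTHESIS
in the text and not a constant in the cone; route TypeILiouville crux
stmt-NavierStokesRegularity-0057) implies StableTangentFlowLiouville — time-shift v by ε
(IsAncientMildSolution.time_translate) to get a bounded ancient mild solution with measurable
(smooth) slices, (L) makes every slice constant, hence curl v ≡ 0 on t < −ε; let ε → 0. Links the
route to TypeILiouville: if (L) lands, crux 3 closes in one line. [difficulty: provable-now]
[KNSS2009, SereginSverak2009, AlbrittonBarker2019]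

TWO-LAYER PLAN. Layer 1 (rev 2): cruxes T (2), S (3), M (4, shared with MarginalTypeI); deciding
theorem `closes` (proved) over T, S, M, GIPL3Stability, CriticalViscosityOfGIP, KatoToClay, and the
Assembly item = the same implication by decl names (closes proves it); further support
AmplitudeMountainPass (F1), FiniteEnstrophyIndex (F2), LiouvilleImpliesStable (not used by
`closes`). Foreseen glued splits, NOT filed: S ⇐ S_dss → S_rec → S with S_dss = the λ-DSS case (U
periodic in s; Floquet form of B_s, period-averaged stability) and S_rec = recurrent/general bounded
orbits; S_dss ⇐ (SignedCubicIdentity: an identity A_s(F[U]) = F′[U] + P[U] for a derived field F[U]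
∈ {curl Ω, ΔΩ, strain eigenfields} whose production P has a sign on the stable complement) →
(NoAlmostFlatStableProfile: B ≤ 0 off the span ⇒ ‖ΔU‖₂ ≲ ‖∇U‖_∞‖∇²U‖₂, the card's first rung) →
S_dss. T ⇐ (TangentFlowBoundedOrbit: threshold + scaled Type I ⇒ some ν-normalised blow-up sequence
converges in L³_loc to a v ∈ 𝒯 with curl v ≢ 0, i.e. a smooth bounded entire orbit |v| ≤ C/√(−t) —
Albritton–Barker/Seregin compactness gives a limit, the sup-rate is a genuine upgrade (automatic for
DSS limits by ChaeWolf2017 Thm 1.1)) → (ThresholdIndexBound: for that v, B_s has at most the ten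
symmetry/amplitude directions of non-negative second variation — the heart) → T.

KILL CRITERIA. (i) A nontrivial Type-I ancient solution in 𝒯 that is enstrophy-stable off the ten
directions (e.g. a backward λ-DSS profile, Blowup's BlowupTypeIDssProfile
stmt-NavierStokesRegularity-0155, whose Floquet–energy form is checked negative on the complement)
refutes S: close --reason refuted:StableTangentFlowLiouville. (ii) A nontrivial member of 𝒯 that is
enstrophy-UNSTABLE in ≥ 2 directions mod symmetries does not refute anything but, if it is shown to
arise as a tangent flow at a threshold, refutes T: pivot T to 'index ≤ k' only if S survives with
finite index k (it does not as filed) — else close. (iii) A Type-II singularity at a critical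
viscosity refutes M (= ¬Clay(A) outright; every positive route closes). (iv)
NontrivialMildAncientTypeIExists-type witnesses with measurable slices refute stmt-1749 but NOT
necessarily S (S only needs the stable sub-case) — the route survives exactly when the witness is
enstrophy-unstable beyond its amplitude. (v) If (L) (stmt-0057) is PROVED, S closes via
LiouvilleImpliesStable and the route reduces to T ∧ M; if MarginalTypeI closes M ∧ (L′), this route
is superseded (close --reason superseded --by route-NavierStokesRegularity-MarginalTypeI).

NOT DECOMPOSED YET. How T is proved (the passage from 'threshold = codimension-one boundary of the
open global set' to a sign of B_s on a B-complement: centre-stable manifold of the profile semiflow,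
Floquet theory in flat vorticity L² — cf. DssFarFieldSlaving's GaussianFloquetTheory for the
Gaussian version —, and the energy-vs-spectral gap D1); the tangent-flow extraction inside T
(Albritton–Barker compactness with moving centres; kept inside T so that the item stays one
statement); the derived-field identities for S beyond the two rungs on the card; the DSS/recurrent
split of S; uniformity of N in F2 over the Type-I class (stated per profile). No finer target than
Thesis = T ∧ S ∧ M.

CHEAPEST FALSIFIER. Compute the enstrophy form B for the numerically known FORWARD self-similar
profiles of Jia–Šverák/Guillod–Šverák (arXiv:1704.00560; forward variables flip the signs of the
drift and scaling terms but the advective, non-normal part is identical) along the bifurcation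
branch: count the positive directions of the symmetrised form versus the unstable eigenvalues of the
linearisation as the profile amplitude σ grows. If the ENERGY index grows without bound while the
spectral index stays 1–2, defect D1 is fatal for T as filed (T must be recast spectrally and S loses
its coercive hypothesis). Planner could not run it (hub is compute-free; a kit job needs the profile
data) — recommended first refuter probe. Already run by hand (this planner): the Gaussian-frame
version of F2 is false (far-field/pressure coupling), which is why the route is filed in flat
vorticity L².

NUMBERS. Coercivity constants (flat L², backward similarity variables, ν=1): vorticity ⟨(Δ − ½y·∇ −
1)ω,ω⟩ = −‖∇ω‖² − ¼‖ω‖² (drift +¾, scaling −1); velocity ⟨(Δ − ½y·∇ − ½)w,w⟩ = −‖∇w‖² + ¼‖w‖²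
(indefinite); forward twin (JiaSverak2015 p.3): σ(Δ + ½x·∇ + ½) ⊆ {Re λ ≤ −¼}. Mountain-pass excess:
B(U,U) = ‖∇Ω‖²₂ + ¼‖Ω‖²₂. Symmetry/amplitude span: 10 directions (1 amplitude + 3 translations + 1
time shift + 3 rotations + 1 scaling + 0 boosts (stable)); for a steady profile at least 5 of them
(amplitude, 3 translations with A∂_jΩ = ½∂_jΩ, time shift with AM = M) have B > 0, rotations and
scaling are neutral. Far-field test (planner): Gaussian frame — far bump at radius R: |Q_far| ~
e^(−R²/4), pressure coupling B_far,near ~ C₀R^(−5), B² ≫ |Q_far||Q_near| ⇒ index ∞; flat vorticity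
frame — |Q_far| ≈ ¼, Biot–Savart coupling ~ R^(−3) ⇒ no spurious directions; velocity frame with
weight (1+|y|²)^(−m) works iff ½ < m < 3/2 (U ∈ L²_ρ and far damping need m > ½; A₂ for the Riesz
pressure needs m < 3/2). Known Liouville cases inside S: steady (NRŠ1996 Thm 1, Tsai1998), λ-DSS
with λ < λ_*(C_*) (ChaeWolf2017 Thm 1.3), axisymmetric (SereginSverak2009). Items at open: 8
(assembly, 3 cruxes of which 1 shared, 4 support of which 1 shared); rev 2: 9 items (3 cruxes of
which 1 shared — T 1997, S 1233, M 759 chars — and 6 support: AmplitudeMountainPass 1084,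
FiniteEnstrophyIndex 859, LiouvilleImpliesStable 1520, GIPL3Stability 1288, CriticalViscosityOfGIP
1718, KatoToClay 589; plus the Assembly item restated by decl names, 155 chars, provable by `exact
closes`); import cone rev 2: KatoMaximalTime, SelfSimilar, SuitableWeak, WeakSolution,
ClassicalSolution, VectorCalculus, MildSolution, LerayHopf, NSWave0 (dropped HyperbolicDSSOrbit,
SelfSimilarLiouville, MildSolutions-direct; the only unproved facts left in the import closure are
MildSolutions' rusin_sverak_minimal_blowup / RusinSverakQuestion, which host HasGlobalKatoSolution
and are not used, and NSWave0's Clay companions, which every route of the summit imports through the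
Statement); new bib keys added: Simons1968, ChodoshLi2021, SchoenSimonYau1975.

DEFINITION REQUESTS. None filed at open: the form B_s, the class 𝒯 and enstrophy-stability are
INLINED (let-bound) in the items so that every crux is typed now (Sketch.lean rc 0). If a grounder
prefers named notions: `enstrophyPairing (U) (s) (w) (w')`, `IsEnstrophyStable (v)` and
`InTangentClass (v)` exactly as in the planner's Sketch.lean (topic
Summits/NavierStokesRegularity/NavierStokesRegularity/Theorems), after which the signatures can be
shortened by set-signature without change of meaning.

Novelty: Searches (2026-08-15): grep of all 48 NavierStokesRegularity route headers for index / second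
variation / stability inequality / Floquet (hits only Floquet: CorkscrewDynamo, DssFarFieldSlaving,
QuantisedSymmetry, CirculationRelay, EulerMelnikovDss — all on the blow-up side, assuming or using
hyperbolicity; none with an energy index or a stable-Bernstein statement); `lit frontier
NavierStokesRegularity --since 2021` (30 rows: forward self-similar 2D, non-uniqueness, ε-regularity
— none on stability indices of profiles); `lit bridges NavierStokesRegularity --cross any` (surveys
only); `lit search --hybrid` local x3 ("linearized stability self-similar profile similarity
variables Gaussian weight" → NRŠ1996, FoiasManleyRosaTemam2001, LemariéRieusset2016; "energy method
Reynolds–Orr" → DoeringGibbon1995 §2.2 pp.31–33, Drazin2002, Joseph1976); `lit galaxy search --star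
all` x4 ("energy stability of self-similar blow-up Navier-Stokes", "stability of self-similar
solutions to the Navier-Stokes", "linear stability of the blow-up profile", "backward self-similar":
0/0/1/5 hits, none relevant); `lit read arXiv:1306.2136` (JiaSverak2015 p.3: forward operator, Σ =
{Re λ ≤ −¼}, K_σ relatively compact, spectral scenarios (A)/(B)); `lit read arXiv:1610.09464`
(ChaeWolf2017 Thms 1.1, 1.3); remote APIs (OpenAlex/S2/zbMATH) were unavailable from this hub during
the session (searchd timeouts) — the card's own audited searches (zbMATH "Navier-Stokes self-similar
profile linear stability index", "  [refs: 1306.2136, 1610.09464, 1704.00560, FoiasManleyRosaTemam2001, DoeringGibbon1995, JiaSverak2015, ChaeWolf2017, GuillodSverak2023, ColdingMinicozzi2012, Serrin1959]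

Barriers (technique_class: stability-inequality, energy-index, liouville-rigidity): - technique_class: stability-inequality, energy-index, liouville-rigidity
- Literature.Barriers.NavierStokesRegularity.LeraySelfSimilarBlowupExclusion: consistent, not an
obstacle — it makes S vacuous for STEADY profiles (NRŠ/Tsai); the content of S is DSS/recurrent
orbits, the barrier's recorded evasion.
- Literature.Barriers.NavierStokesRegularity.TaoAveragedBlowup: it does not evade it in the abstract
— B_s, the mountain pass and F2 are bilinear-form calculus that transfers verbatim to an averaged
B̃, whose blow-up exists; the bet is twofold: M/T fail there for the right reason (Tao's blow-up is
Type II, arXiv:1402.0290 p.8, so the averaged threshold is not in 𝒯), and S must be proved with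
NS-specific derived-field identities (vorticity/strain of the profile, the Schoen–Simon–Yau rungs),
which an averaged nonlinearity does not possess.
- Literature.Barriers.NavierStokesRegularity.TruncatedDyadicBlowup: same concession; its Type-I
facet (TruncatedDyadicTypeIBlowup, exactly DSS from the second mode on) says an abstract Type-I/DSS
exclusion is impossible inside the energy class — S is not abstract: its hypothesis (stability off
ten explicit directions) and its intended proof (signed cubic identity) are profile-geometric; T is
where the dyadic witness would have to be checked (is the dyadic threshold orbit energy-stable off
its amplitude? expected NO — informative either way, kill criterion (ii)).
- Literature.Barriers.NavierStokesRegularity.EnergySupercriticality: partially e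

History (route lifecycle, newest last):
- 2026-08-15T16:18:40Z · rev 2: restated ThresholdEnstrophyStable (stmt-NavierStokesRegularity-8412), StableTangentFlowLiouville (stmt-NavierStokesRegularity-8413), AmplitudeMountainPass (stmt-NavierStokesRegularity-8414), LiouvilleImpliesStable (stmt-NavierStokesRegularity-8416), Assembly (stmt-NavierStokesRegularity-8417) — route-repair (glu (planner-rbadge-NavierStokesRegularity-Amplitud-4a8613be-g4-0)
- 2026-08-15T16:18:40Z · rev 2: dropped CriticalViscosityExists — route-repair (glue + cone), rev 2: (1) deciding theorem `closes : ThresholdEnstrophyStable → StableTangentFlowLiouville → MarginalBlowupTypeI → GIPL3Stability → (planner-rbadge-NavierStokesRegularity-Amplitud-4a8613be-g4-0)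
- 2026-08-22T15:58:13Z · DORMANT — reconciler: no traction for 5.5 d (last activity item-evidence-added at 2026-08-17T04:15:58Z); parked, not closed — `ledger route dormant route-NavierStokesRegu (operator:999:766086)
- 2026-08-26T16:14:54Z · REACTIVATED — reconciler: reactivated — activity item-proof-filed at 2026-08-26T15:14:58Z after parking at 2026-08-22T15:58:13Z (operator:999:396600)
- 2026-09-01T08:52:43Z · DORMANT — reconciler: no traction for 5 d (last activity statement-checked at 2026-08-27T08:09:21Z); parked, not closed — `ledger route dormant route-NavierStokesRegulari (operator:999:4019321)

sub-problem: NavierStokesRegularity · status: dormant · opened planner-plancard-NavierStokesRegularity-Navie-964b8576-0 2026-08-15T12:47:10Z · rev 2 · ledger route-NavierStokesRegularity-AmplitudeIndex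
GENERATED by the gate from the ledger (D-0016/17). Provers cite these decls: `theorem foo : Summit.NavierStokesRegularity.NavierStokesRegularity.Theses.AmplitudeIndex.<Decl> := …` in Summits/NavierStokesRegularity/NavierStokesRegularity/Theorems/<Name>.lean.
-/

namespace Summit.NavierStokesRegularity.NavierStokesRegularity.Theses.AmplitudeIndex

open scoped BigOperators Topology Manifold Classical MeasureTheory ProbabilityTheory Matrix InnerProductSpace ComplexConjugate ContinuousMap
open Filter Set Function TopologicalSpace MeasureTheory

attribute [summit_statement] _root_.NavierStokesRegularity

open Literature.NS

-- earlier ThresholdEnstrophyStable (stmt-NavierStokesRegularity-8412, replaced 2026-08-15T16:18:40Z -> stmt-NavierStokesRegularity-10562): retired by None — ∀ ν : ℝ, 0 < ν → ∀ u₀, (∀ ν' : ℝ, ν < ν' → Literature.Analysis.FluidPDE.HasGlobalKatoSolution ν' u₀) → ¬ Literature.Analysis.FluidPDE.HasGlobalKatoSolution ν u₀ → (∀ T u, 0 < T → Literature.Analysis.FluidPDE.IsKatoSolutionOn T ν u₀ u → ∀ x₀, ∃ r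
/-- item stmt-NavierStokesRegularity-10562 · crux · rank 2 · open · by planner
why it might fail: A_s is non-normal: energy stability is strictly stronger than spectral (R_c^nonlin < R_c^lin, DoeringGibbon1995 p.37), so index one mod symmetries need not give P_s <= 0 on the B-complement and may fail at DSS phases; scaled Type I gives bounded blow-up limits (Seregin2014 Prop 3.10), not sup-rate.
sources: GallagherIftimiePlanchon2003, MatanoMerle2011, DoeringGibbon1995, Seregin2014, JiaSverak2015, GuillodSverak2023
[crux] (T) THRESHOLD ⇒ INDEX ONE, REALISED BY THE AMPLITUDE (card S1, repaired frame). For ν>0 and a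
CLAY datum u₀ (C^∞, div-free, rapidly decaying — rev 2: exactly the hypotheses MarginalBlowupTypeI
carries; the earlier signature quantified over all u₀) at a critical viscosity —
HasGlobalKatoSolution ν' u₀ for all ν'>ν, ¬HasGlobalKatoSolution ν u₀ (for Clay data = amplitude
threshold A_c = 1 on the ray A•u₀, hasGlobalKatoSolution_smul_iff) — whose Kato solutions obey the
local scaled-L³ Type-I bound (verbatim the conclusion of MarginalBlowupTypeI), there is v ∈ 𝒯
(IsAncientMildSolution 1 v; C^∞ on t<0; |v| ≤ C/√(−t), i.e. U = lerayOrbit v is a smooth bounded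
entire orbit) which is ENSTROPHY-STABLE — for every s and every C_c^∞ div-free w with B_s(w,
DU(s)[a+σy+Ay] + (σ+τ)U(s) − AU(s) + ρ∂_sU(s)) = 0 for all a ∈ ℝ³, σ,τ,ρ ∈ ℝ, A ∈ so(3): P_s(w,w) ≤
0, with P_s, B_s as in § Thesis — and has curl v ≢ 0. Intended (not encoded, for length): v is a
ν-normalised blow-up limit (c_k/ν)u(t_k + c_k²t/ν, x_k + c_kx) → v at a singular point of the
threshold Kato solution; that SOME blow-up sequence yields a smooth bounded entire orbit is part of
the claim and more than M's scaled-L³ Type I giv -/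
@[route_item "route-NavierStokesRegularity-AmplitudeIndex", crux]
def ThresholdEnstrophyStable : Prop :=
  ∀ ν : ℝ, 0 < ν → ∀ u₀ : EuclideanSpace ℝ (Fin 3) → EuclideanSpace ℝ (Fin 3), ContDiff ℝ (⊤ : ℕ∞) u₀ → Literature.Analysis.FluidPDE.NSWave0.IsDivFree u₀ → Literature.Analysis.FluidPDE.HasRapidSpatialDecay u₀ → (∀ ν' : ℝ, ν < ν' → Literature.Analysis.FluidPDE.HasGlobalKatoSolution ν' u₀) → ¬ Literature.Analysis.FluidPDE.HasGlobalKatoSolution ν u₀ → (∀ (T : ℝ) (u : ℝ → EuclideanSpace ℝ (Fin 3) → EuclideanSpace ℝ (Fin 3)), 0 < T → Literature.Analysis.FluidPDE.IsKatoSolutionOn T ν u₀ u → ∀ x₀ : EuclideanSpace ℝ (Fin 3), ∃ r₀ : ℝ, 0 < r₀ ∧ (⨆ (r : ℝ) (_ : 0 < r) (z : ℝ × EuclideanSpace ℝ (Fin 3)) (_ : Literature.Analysis.FluidPDE.parabolicCylinder r z ⊆ Literature.Analysis.FluidPDE.parabolicCylinder r₀ (T, x₀)), Literature.Analysis.FluidPDE.cknC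 r z u) < ⊤) → ∃ v : ℝ → EuclideanSpace ℝ (Fin 3) → EuclideanSpace ℝ (Fin 3), Literature.Analysis.FluidPDE.IsAncientMildSolution 1 v ∧ ContDiffOn ℝ (⊤ : ℕ∞) (Function.uncurry v) (Set.Iio 0 ×ˢ Set.univ) ∧ (∃ C : ℝ, Literature.Analysis.FluidPDE.HasTypeITimeDecay C v) ∧ (let curl := Literature.Analysis.FluidPDE.curl; let cross := Literature.Analysis.FluidPDE.cross; let U := fun (s : ℝ) (y : EuclideanSpace ℝ (Fin 3)) => Real.exp (-s / 2) • v (-Real.exp (-s)) (Real.exp (-s / 2) • y); let P := fun s w w' => ∫ y, (-(∑ i : Fin 3, inner ℝ (fderiv ℝ (curl w) y (EuclideanSpace.single i (1 : ℝ))) (fderiv ℝ (curl w') y (EuclideanSpace.single i (1 : ℝ)))) - (1 / 4 : ℝ) * inner ℝ (curl w y) (curl w' y) + inner ℝ (cross (U s y) (curl w y) + cross (w y) (curl (U s) y)) (curl (curl w') y)); let B := fun s w w' => P s w w' + P s w' w; ∀ s w, ContDiff ℝ (⊤ : ℕ∞) w → HasCompactSupport w → Literature.Analysis.FluidPDE.VectorCalculus.IsDivFree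 w → (∀ a (σ τ ρ : ℝ), ∀ A ∈ skewAdjoint (EuclideanSpace ℝ (Fin 3) →L[ℝ] EuclideanSpace ℝ (Fin 3)), B s w (fun y => fderiv ℝ (U s) y (a + σ • y + A y) + (σ + τ) • U s y - A (U s y) + ρ • Literature.Analysis.FluidPDE.timeDeriv U s y) = 0) → P s w w ≤ 0) ∧ ∃ t < 0, ∃ x, Literature.Analysis.FluidPDE.curl (v t) x ≠ 0

-- earlier StableTangentFlowLiouville (stmt-NavierStokesRegularity-8413, replaced 2026-08-15T16:18:40Z -> stmt-NavierStokesRegularity-10563): retired by None — ∀ v, Literature.Analysis.FluidPDE.IsAncientMildSolution 1 v → ContDiffOn ℝ (⊤ : ℕ∞) (Function.uncurry v) (Set.Iio 0 ×ˢ Set.univ) → (∃ C : ℝ, Literature.Analysis.FluidPDE.HasTypeITimeDecay C v) → (let curl := Literature.Analysis.FluidPDE.curl; 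
/-- item stmt-NavierStokesRegularity-10563 · crux · rank 3 · open · by planner
why it might fail: No Simons-type identity with a SIGNED cubic term is known for NS profiles; cut-off errors for bounded non-decaying orbits are borderline (critical class); one enstrophy-stable Type-I DSS or recurrent ancient solution refutes it; TypeIDSSLiouvilleConjecture is open (BradshawTsai2017CPDE, OP 5.1).
sources: Simons1968, SchoenSimonYau1975, ChodoshLi2021, ColdingMinicozzi2012, NecasRuzickaSverak1996, Tsai1998
[crux] (S) BERNSTEIN THEOREM FOR ENSTROPHY-STABLE TANGENT FLOWS (card S2, repaired frame). Every v
with IsAncientMildSolution 1 v, C^∞ on (−∞,0)×ℝ³ and |v(t,x)| ≤ C/√(−t) which is enstrophy-stable in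
the sense of crux 2 (P_s(w,w) ≤ 0 for all s and all test w that are B_s-orthogonal to the
ten-parameter symmetry/amplitude family of U(s) = lerayOrbit v s) is irrotational: curl v ≡ 0 on t<0
(the conclusion is stated on the vorticity so that the x-independent parasitic solutions b(t) of the
duality-form mild class, which are enstrophy-stable, are not counterexamples; modulo them v ≡ 0).
Steady profiles: vacuous by NRŠ1996/Tsai1998; λ-DSS with λ near 1: ChaeWolf2017 Thm 1.3;
axisymmetric: SereginSverak2009; content = DSS with λ away from 1 and recurrent/general bounded
orbits — the STABLE sub-case of TypeIDSSLiouvilleConjecture / (L′), implied by (L) (support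
LiouvilleImpliesStable), strictly weaker than stmt-NavierStokesRegularity-1749. Intended tool
(Schoen–Simon–Yau): insert derived fields of U (curl Ω, ΔΩ, strain eigenfields) as w into P_s ≤ 0
after B_s-projecting off the family and subtract the identities they satisfy (first rungs on the
card); the mountain-pass excess ‖∇Ω‖²+¼‖Ω‖² -/
@[route_item "route-NavierStokesRegularity-AmplitudeIndex", crux]
def StableTangentFlowLiouville : Prop :=
  ∀ v : ℝ → EuclideanSpace ℝ (Fin 3) → EuclideanSpace ℝ (Fin 3), Literature.Analysis.FluidPDE.IsAncientMildSolution 1 v → ContDiffOn ℝ (⊤ : ℕ∞) (Function.uncurry v) (Set.Iio 0 ×ˢ Set.univ) → (∃ C : ℝ, Literature.Analysis.FluidPDE.HasTypeITimeDecay C v) → (let curl := Literature.Analysis.FluidPDE.curl; let cross := Literature.Analysis.FluidPDE.cross; let U := fun (s : ℝ) (y : EuclideanSpace ℝ (Fin 3)) => Real.exp (-s / 2) • v (-Real.exp (-s)) (Real.exp (-s / 2) • y); let P := fun s w w' => ∫ y, (-(∑ i : Fin 3, inner ℝ (fderiv ℝ (curl w) y (EuclideanSpace.single i (1 : ℝ)))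 (fderiv ℝ (curl w') y (EuclideanSpace.single i (1 : ℝ)))) - (1 / 4 : ℝ) * inner ℝ (curl w y) (curl w' y) + inner ℝ (cross (U s y) (curl w y) + cross (w y) (curl (U s) y)) (curl (curl w') y)); let B := fun s w w' => P s w w' + P s w' w; ∀ s w, ContDiff ℝ (⊤ : ℕ∞) w → HasCompactSupport w → Literature.Analysis.FluidPDE.VectorCalculus.IsDivFree w → (∀ a (σ τ ρ : ℝ), ∀ A ∈ skewAdjoint (EuclideanSpace ℝ (Fin 3) →L[ℝ] EuclideanSpace ℝ (Fin 3)), B s w (fun y => fderiv ℝ (U s) y (a + σ • y + A y) + (σ + τ) • U s y - A (U s y) + ρ • Literature.Analysis.FluidPDE.timeDeriv U s y) = 0) → P s w w ≤ 0) → ∀ t < 0, ∀ x, Literature.Analysis.FluidPDE.curl (v t) x = 0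

/-- item stmt-NavierStokesRegularity-1748 · crux · rank 4 · open · by planner
why it might fail: A codimension-one Type-II mechanism could sit on the boundary of the global set; Tao's averaged NS blows up at Type-II rate (arXiv:1402.0290 p.8), so no averaging-insensitive proof exists; free global families carry arbitrarily concentrated bursts.
sources: MatanoMerle2011, Tao2016AveragedNS, GallagherIftimiePlanchon2003, Seregin2006, AlbrittonBarker2019
[crux] MARGINAL BLOW-UP IS TYPE I (card threshold-marginal-blowup-dichotomy, branch ¬β ⇒ α in its
weakest assembly-sufficient form). For ν>0 and a Clay datum u₀ (C^∞, div-free, rapidly decaying) at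
its CRITICAL VISCOSITY — HasGlobalKatoSolution ν' u₀ for all ν'>ν and ¬HasGlobalKatoSolution ν u₀
(equivalently amplitude threshold A_c = 1 on the ray A•u₀ at fixed ν,
KatoViscosityScaling.hasGlobalKatoSolution_smul_iff; the blow-up is a limit of GLOBAL smooth
solutions, GIP2003 Thm 3.1) — every Kato solution u on [0,T) (in particular the one on [0,T_max))
has at every x₀ an r₀>0 with sup over parabolic sub-balls Q_r(z) ⊆ Q_{r₀}(T,x₀) of
C(r,z;u)=r⁻²∫∫_{Q_r(z)}|u|³ finite: Type I in the scaled sense of Seregin2006/AlbrittonBarker2019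
(for T<T_max it is trivial, u being bounded on [T−r₀²,T]). Equivalent along the family to the card's
Galilean-invariant oscillation bound (telescoping means + uniform energy). Model theorems:
MatanoMerle2011 (radial supercritical NLH: threshold ⇒ Type I), BizoChmajTabor2004,
GundlachMartingarcia2007 (critical collapse: threshold solutions are self-similar, one unstable
mode). Why it might fail: see why_might_fail; refutation = a Type-II singularity at a crit -/
@[route_item "route-NavierStokesRegularity-AmplitudeIndex", crux]
def MarginalBlowupTypeI : Prop :=
  ∀ ν : ℝ, 0 < ν → ∀ u₀ : EuclideanSpace ℝ (Fin 3) → EuclideanSpace ℝ (Fin 3), ContDiff ℝ (⊤ : ℕ∞) u₀ → Literature.Analysis.FluidPDE.NSWave0.IsDivFree u₀ → Literature.Analysis.FluidPDE.HasRapidSpatialDecay u₀ → (∀ ν' : ℝ, ν < ν' → Literature.Analysis.FluidPDE.HasGlobalKatoSolution ν' u₀) → ¬ Literature.Analysis.FluidPDE.HasGlobalKatoSolution ν u₀ → ∀ (T : ℝ) (u : ℝ → EuclideanSpace ℝ (Fin 3) → EuclideanSpace ℝ (Fin 3)), 0 < T → Literature.Analysis.FluidPDE.IsKatoSolutionOn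 T ν u₀ u → ∀ x₀ : EuclideanSpace ℝ (Fin 3), ∃ r₀ : ℝ, 0 < r₀ ∧ (⨆ (r : ℝ) (_ : 0 < r) (z : ℝ × EuclideanSpace ℝ (Fin 3)) (_ : Literature.Analysis.FluidPDE.parabolicCylinder r z ⊆ Literature.Analysis.FluidPDE.parabolicCylinder r₀ (T, x₀)), Literature.Analysis.FluidPDE.cknC r z u) < ⊤

-- earlier AmplitudeMountainPass (stmt-NavierStokesRegularity-8414, replaced 2026-08-15T16:18:40Z -> stmt-NavierStokesRegularity-10564): retired by None — ∀ (v : ℝ → EuclideanSpace ℝ (Fin 3) → EuclideanSpace ℝ (Fin 3)) (p : ℝ → EuclideanSpace ℝ (Fin 3) → ℝ), Literature.Analysis.FluidPDE.IsClassicalNSSolutionOn (Set.Iio 0) 1 0 v p → (∀ n : ℕ, n ≤ 3 → ∃ C : ℝ, ∀ t < 0, ∀ x : EuclideanSpace ℝ (Fin 3), ‖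
/-- item stmt-NavierStokesRegularity-10564 · support · rank 9 · closed · proved by Summit.NavierStokesRegularity.NavierStokesRegularity.Theorems.amplitudeIndex_amplitudeMountainPass_proof (prover) · by planner
sources: DoeringGibbon1995, ChaeWolf2017RemovingDSS, Simons1968
[support] (F1) EVERY ORBIT IS ENSTROPHY-UNSTABLE ALONG ITS OWN AMPLITUDE, on average. For a
classical NS solution (ν=1, zero force) on t<0 with the parabolic Type-I envelope up to third
derivatives (|∇ⁿv(t,x)| ≤ C/(|x|+√−t)^(n+1), n ≤ 3), the orbit U = lerayOrbit v satisfies for s₁ ≤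
s₂: ∫_(s₁)^(s₂) P_s(U(s),U(s)) ds = ‖curl U(s₂)‖²₂ − ‖curl U(s₁)‖²₂ + ∫_(s₁)^(s₂)(‖∇curl U‖²₂ +
¼‖curl U‖²₂) ds. Proof: A_s Ω = 2∂_sΩ − (Δ − ½y·∇ − 1)Ω from the vorticity equation in similarity
variables, and ⟨(Δ − ½y·∇ − 1)Ω, Ω⟩ = −‖∇Ω‖² − ¼‖Ω‖² (drift contributes +¾, scaling −1); steady
case: P(U,U) = ‖∇Ω‖² + ¼‖Ω‖² > 0 unless Ω ≡ 0 (Simons' 'cones are unstable' with a one-line proof;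
sanity anchor of the frame). [difficulty: M] (Rev 2, route-repair 2026-08-15: U = lerayOrbit v is
WRITTEN OUT in the signature as U s y = e^(−s/2) • v(−e^(−s)) (e^(−s/2) • y) — definitionally
lerayOrbit v — so that HyperbolicDSSOrbit/SelfSimilarLiouville leave the route's cone; meaning
unchanged.) -/
@[route_item "route-NavierStokesRegularity-AmplitudeIndex"]
def AmplitudeMountainPass : Prop :=
  ∀ (v : ℝ → EuclideanSpace ℝ (Fin 3) → EuclideanSpace ℝ (Fin 3)) (p : ℝ → EuclideanSpace ℝ (Fin 3) → ℝ), Literature.Analysis.FluidPDE.IsClassicalNSSolutionOn (Set.Iio 0) 1 0 v p → (∀ n : ℕ, n ≤ 3 → ∃ C : ℝ, ∀ t < 0, ∀ x : EuclideanSpace ℝ (Fin 3), ‖iteratedFDeriv ℝ n (v t) x‖ ≤ C / (‖x‖ + Real.sqrt (-t)) ^ (n + 1)) → ∀ s₁ s₂ : ℝ, s₁ ≤ s₂ → (let curl := Literature.Analysis.FluidPDE.curl; let cross := Literature.Analysis.FluidPDE.cross; let U := fun (s : ℝ) (y : EuclideanSpace ℝ (Fin 3)) => Real.exp (-s / 2)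 • v (-Real.exp (-s)) (Real.exp (-s / 2) • y); let P := fun s w w' => ∫ y, (-(∑ i : Fin 3, inner ℝ (fderiv ℝ (curl w) y (EuclideanSpace.single i (1 : ℝ))) (fderiv ℝ (curl w') y (EuclideanSpace.single i (1 : ℝ)))) - (1 / 4 : ℝ) * inner ℝ (curl w y) (curl w' y) + inner ℝ (cross (U s y) (curl w y) + cross (w y) (curl (U s) y)) (curl (curl w') y)); ∫ s in s₁..s₂, P s (U s) (U s) = (∫ y, ‖curl (U s₂) y‖ ^ 2) - (∫ y, ‖curl (U s₁) y‖ ^ 2) + ∫ s in s₁..s₂, ∫ y, ((∑ i : Fin 3, ‖fderiv ℝ (curl (U s)) y (EuclideanSpace.single i (1 : ℝ))‖ ^ 2) + (1 / 4 : ℝ) * ‖curl (U s) y‖ ^ 2))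

-- `AmplitudeMountainPass` holds: proved by `Summit.NavierStokesRegularity.NavierStokesRegularity.Theorems.amplitudeIndex_amplitudeMountainPass_proof` (its module imports this route file, so no `_holds` link can be stated here).

-- earlier LiouvilleImpliesStable (stmt-NavierStokesRegularity-8416, replaced 2026-08-15T16:18:40Z -> stmt-NavierStokesRegularity-10565): retired by None — Literature.Analysis.FluidPDE.LiouvilleConjectureNS → ∀ v, Literature.Analysis.FluidPDE.IsAncientMildSolution 1 v → ContDiffOn ℝ (⊤ : ℕ∞) (Function.uncurry v) (Set.Iio 0 ×ˢ Set.univ) → (∃ C : ℝ, Literature.Analysis.FluidPDE.HasTypeITimeDecay C v) →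
/-- item stmt-NavierStokesRegularity-10565 · support · rank 9 · closed · proved by Summit.NavierStokesRegularity.NavierStokesRegularity.Theorems.amplitudeIndex_liouvilleImpliesStable_proof (prover) · by planner
sources: KNSS2009, SereginSverak2009, AlbrittonBarker2019
[support] (L) ⇒ (S): KNSS's Liouville conjecture (L) — rev 2: WRITTEN OUT verbatim (every bounded
ancient mild solution with measurable slices has a.e.-constant slices; Iff.rfl-equal to Literature's
cite-only LiouvilleConjectureNS, which is therefore no longer a constant in the route's cone; =
route TypeILiouville crux stmt-NavierStokesRegularity-0057) — implies StableTangentFlowLiouville —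
time-shift v by ε (IsAncientMildSolution.time_translate) to get a bounded ancient mild solution with
measurable (smooth) slices, (L) makes every slice constant, hence curl v ≡ 0 on t < −ε; let ε → 0.
Links the route to TypeILiouville: if (L) lands, crux 3 closes in one line. [difficulty:
provable-now] (U = lerayOrbit v written out as in crux 3.) -/
@[route_item "route-NavierStokesRegularity-AmplitudeIndex"]
def LiouvilleImpliesStable : Prop :=
  (∀ u : ℝ → EuclideanSpace ℝ (Fin 3) → EuclideanSpace ℝ (Fin 3), Literature.Analysis.FluidPDE.IsBoundedAncientMildSolution 1 u → (∀ t < 0, MeasureTheory.AEStronglyMeasurable (u t) MeasureTheory.volume) → ∀ t < 0, ∃ b : EuclideanSpace ℝ (Fin 3), u t =ᵐ[MeasureTheory.volume] fun _ => b) → ∀ v : ℝ → EuclideanSpace ℝ (Fin 3) → EuclideanSpace ℝ (Fin 3), Literature.Analysis.FluidPDE.IsAncientMildSolution 1 v → ContDiffOn ℝ (⊤ : ℕ∞) (Function.uncurry v) (Set.Iio 0 ×ˢ Set.univ) → (∃ C : ℝ, Literature.Analysis.FluidPDE.HasTypeITimeDecay C v) → (let curl := Literature.Analysis.FluidPDE.curl;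 let cross := Literature.Analysis.FluidPDE.cross; let U := fun (s : ℝ) (y : EuclideanSpace ℝ (Fin 3)) => Real.exp (-s / 2) • v (-Real.exp (-s)) (Real.exp (-s / 2) • y); let P := fun s w w' => ∫ y, (-(∑ i : Fin 3, inner ℝ (fderiv ℝ (curl w) y (EuclideanSpace.single i (1 : ℝ))) (fderiv ℝ (curl w') y (EuclideanSpace.single i (1 : ℝ)))) - (1 / 4 : ℝ) * inner ℝ (curl w y) (curl w' y) + inner ℝ (cross (U s y) (curl w y) + cross (w y) (curl (U s) y)) (curl (curl w') y)); let B := fun s w w' => P s w w' + P s w' w; ∀ s w, ContDiff ℝ (⊤ : ℕ∞) w → HasCompactSupport w → Literature.Analysis.FluidPDE.VectorCalculus.IsDivFree w → (∀ a (σ τ ρ : ℝ), ∀ A ∈ skewAdjoint (EuclideanSpace ℝ (Fin 3) →L[ℝ] EuclideanSpace ℝ (Fin 3)), B s w (fun y => fderiv ℝ (U s) y (a + σ • y + A y) + (σ + τ) • U s y - A (U s y) + ρ • Literature.Analysis.FluidPDE.timeDeriv U s y) = 0) → P s w w ≤ 0) → ∀ t < 0, ∀ x, Literature.Analysis.FluidPDE.curl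 (v t) x = 0

-- `LiouvilleImpliesStable` holds: proved by `Summit.NavierStokesRegularity.NavierStokesRegularity.Theorems.amplitudeIndex_liouvilleImpliesStable_proof` (its module imports this route file, so no `_holds` link can be stated here).

/-- item stmt-NavierStokesRegularity-10567 · support · rank 9 · closed · proved by Summit.NavierStokesRegularity.NavierStokesRegularity.Theorems.amplitudeIndex_criticalViscosityOfGIP_proof (prover) · by planner
sources: GallagherIftimiePlanchon2003, RusinSverak2011, Kato1984
[support] CRITICAL VISCOSITY FROM L³-STABILITY (rev 2; replaces in this route the shared
CriticalViscosityExists = stmt-NavierStokesRegularity-1750, which stays with MarginalTypeI):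
GIPL3Stability (its text, verbatim, as antecedent) → for ν>0 and a Clay datum u₀ with
¬HasGlobalKatoSolution ν u₀ there is a critical viscosity ν_c ≥ ν (¬HasGlobalKatoSolution ν_c u₀ and
HasGlobalKatoSolution ν' u₀ for every ν' > ν_c). Proof (provable now, M): N := {ν' ≥ ν :
¬HasGlobalKatoSolution ν' u₀} ∋ ν is bounded — small-data global existence at large viscosity
(fujita_kato_global_small_holds / kato_global_small transported by
KatoViscosityScaling.hasGlobalKatoSolution_smul_iff: HasGlobalKatoSolution ν' u₀ ↔
HasGlobalKatoSolution 1 (ν'⁻¹ • u₀), and ‖ν'⁻¹u₀‖_(L³) → 0) — and ν_c := sup N is attained because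
{ν' : HasGlobalKatoSolution ν' u₀} is open: GIP2003_L3_stability.exists_ball_hasGlobalKatoSolution
(GIPGlobalStability.lean, proved from the fact) applied to the antecedent (which is
GIP2003_L3_stability by Iff.rfl) plus continuity of ν' ↦ ν'⁻¹ • u₀ in L³; a Clay datum is in L³ and
weakly div-free (cf. ThinOrFatPincer's ClayDataInL3). In `closes` this item is fed GIPL3Stability.
[difficulty: M] [ -/
@[route_item "route-NavierStokesRegularity-AmplitudeIndex", crux]
def CriticalViscosityOfGIP : Prop :=
  (∀ (u₀ : EuclideanSpace ℝ (Fin 3) → EuclideanSpace ℝ (Fin 3)) (u : ℝ → EuclideanSpace ℝ (Fin 3) → EuclideanSpace ℝ (Fin 3)), MeasureTheory.MemLp u₀ 3 MeasureTheory.volume → Literature.Analysis.FluidPDE.IsWeaklyDivFree u₀ → Literature.Analysis.FluidPDE.IsGlobalMildSolution 1 0 u₀ u → Literature.Analysis.FluidPDE.ContinuousInLpOn (Set.Ici 0) 3 u → u 0 = u₀ → MeasureTheory.AEStronglyMeasurable (Function.uncurry u) (MeasureTheory.volume.restrict (Set.Ioi 0 ×ˢ Set.univ)) → Filter.Tendsto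 (fun t => MeasureTheory.eLpNorm (u t) 3 MeasureTheory.volume) Filter.atTop (nhds 0) ∧ ∃ ε C : ℝ, 0 < ε ∧ ∀ v₀ : EuclideanSpace ℝ (Fin 3) → EuclideanSpace ℝ (Fin 3), MeasureTheory.MemLp v₀ 3 MeasureTheory.volume → Literature.Analysis.FluidPDE.IsWeaklyDivFree v₀ → MeasureTheory.eLpNorm (v₀ - u₀) 3 MeasureTheory.volume < ENNReal.ofReal ε → ∃ v : ℝ → EuclideanSpace ℝ (Fin 3) → EuclideanSpace ℝ (Fin 3), Literature.Analysis.FluidPDE.IsGlobalMildSolution 1 0 v₀ v ∧ Literature.Analysis.FluidPDE.ContinuousInLpOn (Set.Ici 0) 3 v ∧ v 0 = v₀ ∧ MeasureTheory.AEStronglyMeasurable (Function.uncurry v) (MeasureTheory.volume.restrict (Set.Ioi 0 ×ˢ Set.univ)) ∧ ∀ t : ℝ, 0 ≤ t → MeasureTheory.eLpNorm (v t - u t) 3 MeasureTheory.volume ≤ ENNReal.ofReal C * MeasureTheory.eLpNorm (v₀ - u₀) 3 MeasureTheory.volume) → ∀ ν : ℝ, 0 < ν → ∀ u₀ : EuclideanSpace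 ℝ (Fin 3) → EuclideanSpace ℝ (Fin 3), ContDiff ℝ (⊤ : ℕ∞) u₀ → Literature.Analysis.FluidPDE.NSWave0.IsDivFree u₀ → Literature.Analysis.FluidPDE.HasRapidSpatialDecay u₀ → ¬ Literature.Analysis.FluidPDE.HasGlobalKatoSolution ν u₀ → ∃ νc : ℝ, ν ≤ νc ∧ ¬ Literature.Analysis.FluidPDE.HasGlobalKatoSolution νc u₀ ∧ ∀ ν' : ℝ, νc < ν' → Literature.Analysis.FluidPDE.HasGlobalKatoSolution ν' u₀

-- `CriticalViscosityOfGIP` holds: proved by `Summit.NavierStokesRegularity.NavierStokesRegularity.Theorems.amplitudeIndex_criticalViscosityOfGIP_proof` (its module imports this route file, so no `_holds` link can be stated here).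

/-- item stmt-NavierStokesRegularity-10568 · support · rank 9 · closed · proved by Summit.NavierStokesRegularity.NavierStokesRegularity.Theorems.amplitudeIndex_katoToClay_proof (prover) · by planner
sources: Kato1984, LemarieRieusset2016, FujitaKato1964
[support] KATO → CLAY bridge (hypothesis of the deciding theorem `closes`; provable now in ONE
line): a smooth, divergence-free, rapidly decaying datum with a global Kato solution (C([0,∞);L³)
mild) has a jointly smooth bounded-energy Clay solution (u,p). VERBATIM the named fact
Literature.Analysis.FluidPDE.clay_solution_of_hasGlobalKatoSolution (NSKatoToClay.lean), DISCHARGED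
in tree: `theorem … : KatoToClay :=
Literature.Analysis.FluidPDE.clay_solution_of_hasGlobalKatoSolution_holds` (NSKatoToClayHolds.lean;
Kato 1984 Thm 4, von Wahl / Lemarié-Rieusset 2016 Prop 12.3). Same signature as ThinOrFatPincer's
stmt-NavierStokesRegularity-8948 and MinimalBlowupRigidity's stmt-NavierStokesRegularity-0108
(shared). The proved fact's file is deliberately NOT imported by the route (its import closure
carries unrelated named facts); the prover's Theorems file imports it. [difficulty: provable-now]
[sources: Kato1984, LemarieRieusset2016, FujitaKato1964] -/
@[route_item "route-NavierStokesRegularity-AmplitudeIndex", crux]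
def KatoToClay : Prop :=
  ∀ ν : ℝ, 0 < ν → ∀ u₀ : EuclideanSpace ℝ (Fin 3) → EuclideanSpace ℝ (Fin 3), ContDiff ℝ (⊤ : ℕ∞) u₀ → Literature.Analysis.FluidPDE.NSWave0.IsDivFree u₀ → Literature.Analysis.FluidPDE.HasRapidSpatialDecay u₀ → Literature.Analysis.FluidPDE.HasGlobalKatoSolution ν u₀ → ∃ (u : ℝ → EuclideanSpace ℝ (Fin 3) → EuclideanSpace ℝ (Fin 3)) (p : ℝ → EuclideanSpace ℝ (Fin 3) → ℝ), Literature.Analysis.FluidPDE.IsSmoothOnHalfSpace u ∧ Literature.Analysis.FluidPDE.IsSmoothOnHalfSpace p ∧ Literature.Analysis.FluidPDE.IsNavierStokesSolution ν 0 u₀ u p ∧ Literature.Analysis.FluidPDE.HasBoundedEnergy u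

-- `KatoToClay` holds: proved by `Summit.NavierStokesRegularity.NavierStokesRegularity.Theorems.amplitudeIndex_katoToClay_proof` (its module imports this route file, so no `_holds` link can be stated here).

/-- item stmt-NavierStokesRegularity-8415 · support · rank 9 · open · by planner
sources: JiaSverak2015, SteinWeiss1971, DoeringGibbon1995, GallayWayne2005
[support] (F2) FINITE ENSTROPHY INDEX OF A FROZEN TYPE-I PROFILE. For a smooth field U on ℝ³ with
|U| ≤ C/(1+|y|) and |curl U| ≤ C/(1+|y|)², there is N such that any family of test velocity fields
w₁..w_n (C_c^∞, div-free) on whose span the frozen quadratic form P(w,w) (crux 2 with U(s) ≡ U) is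
positive definite has n ≤ N. Proof sketch: P(w,w) ≤ −½‖∇ω‖² − ¼‖ω‖² + K(ω), ω = curl w, where
|∫(U×ω)·curl ω| ≤ ∫ C(1+|y|)⁻¹|ω||∇ω| (decaying potential) and ‖curl U · w‖₂ ≤ C‖(1+|y|)⁻² BS[ω]‖₂ ≲
‖ω‖₂ by Hardy's inequality and ‖∇BS[ω]‖₂ ≲ ‖ω‖₂ (SteinWeiss1971), both form-compact relative to H¹
(Rellich locally, smallness at infinity) — the flat-vorticity analogue of JiaSverak2015's relative
compactness of K_σ; min–max. (In the Gaussian frame of the card this statement is FALSE — see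
Numbers.) [difficulty: L] -/
@[route_item "route-NavierStokesRegularity-AmplitudeIndex"]
def FiniteEnstrophyIndex : Prop :=
  ∀ (C : ℝ) (U : EuclideanSpace ℝ (Fin 3) → EuclideanSpace ℝ (Fin 3)), ContDiff ℝ (⊤ : ℕ∞) U → (∀ y, ‖U y‖ ≤ C / (1 + ‖y‖) ∧ ‖Literature.Analysis.FluidPDE.curl U y‖ ≤ C / (1 + ‖y‖) ^ 2) → (let curl := Literature.Analysis.FluidPDE.curl; let cross := Literature.Analysis.FluidPDE.cross; let P := fun w w' => ∫ y, (-(∑ i : Fin 3, inner ℝ (fderiv ℝ (curl w) y (EuclideanSpace.single i (1 : ℝ))) (fderiv ℝ (curl w') y (EuclideanSpace.single i (1 : ℝ)))) - (1 / 4 : ℝ) * inner ℝ (curl w y) (curl w' y) + inner ℝ (cross (U y) (curl w y) + cross (w y) (curl U y)) (curl (curl w') y)); ∃ N : ℕ, ∀ (n : ℕ) (w : Fin n → EuclideanSpace ℝ (Fin 3) → EuclideanSpace ℝ (Fin 3)), (∀ i, ContDiff ℝ (⊤ : ℕ∞) (w i) ∧ HasCompactSupport (w i) ∧ Literature.Analysis.FluidPDE.VectorCalculus.IsDivFree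 (w i)) → (∀ a : Fin n → ℝ, a ≠ 0 → 0 < P (∑ i, a i • w i) (∑ i, a i • w i)) → n ≤ N)

/-- item stmt-NavierStokesRegularity-9379 · support · rank 9 · closed · proved by Summit.NavierStokesRegularity.NavierStokesRegularity.Theorems.amplitudeIndex_gipL3Stability_proof (prover) · by planner
[support] GIP L³-STABILITY (Gallagher–Iftimie–Planchon, Ann. Inst. Fourier 53 (2003) 1387–1424, Thm
0.1 p.1389; Thm 2.1, Thm 3.1–3.2 (10) pp.1398–1399), unit viscosity as printed: if a weakly div-free
u₀ ∈ L³ has a global Kato solution u ∈ C([0,∞);L³) (mild, u 0 = u₀, measurable), then ‖u(t)‖_(L³) →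
0 as t → ∞ and there are ε, C with: every weakly div-free v₀ ∈ L³ with ‖v₀ − u₀‖_(L³) < ε has a
global Kato solution v with ‖v(t) − u(t)‖_(L³) ≤ C‖v₀ − u₀‖_(L³) for t ≥ 0 (so the set of L³ data
with a global solution is open). VERBATIM the tree's named fact
Literature.Analysis.FluidPDE.GIP2003_L3_stability (GIPGlobalStability.lean:96; `Iff.rfl` checked in
the planner's SketchCheck.lean; UNPROVED in tree = literature debt): the item closes by `exact
GIP2003_L3_stability_holds` the moment the fact is proved. Filed as an item at rev 2 (cone repair)
because it is the ONE literature fact this route genuinely needs — it discharges the hypothesis of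
CriticalViscosityExists in the Assembly (needs-fact: GIP2003_L3_stability) — while its file stays
out of the route's import cone (it imports KatoViscosityScaling → MildSolutions). [difficulty: L
(literature debt)] [sources: GallagherIftimiePlanchon -/
@[route_item "route-NavierStokesRegularity-AmplitudeIndex", crux]
def GIPL3Stability : Prop :=
  ∀ (u₀ : EuclideanSpace ℝ (Fin 3) → EuclideanSpace ℝ (Fin 3)) (u : ℝ → EuclideanSpace ℝ (Fin 3) → EuclideanSpace ℝ (Fin 3)), MeasureTheory.MemLp u₀ 3 MeasureTheory.volume → Literature.Analysis.FluidPDE.IsWeaklyDivFree u₀ → Literature.Analysis.FluidPDE.IsGlobalMildSolution 1 0 u₀ u → Literature.Analysis.FluidPDE.ContinuousInLpOn (Set.Ici 0) 3 u → u 0 = u₀ → MeasureTheory.AEStronglyMeasurable (Function.uncurry u) (MeasureTheory.volume.restrict (Set.Ioi 0 ×ˢ Set.univ)) → Filter.Tendsto (fun t => MeasureTheory.eLpNorm (u t) 3 MeasureTheory.volume) Filter.atTop (nhds 0) ∧ ∃ ε C : ℝ, 0 < ε ∧ ∀ v₀ : EuclideanSpace ℝ (Fin 3) → EuclideanSpace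 ℝ (Fin 3), MeasureTheory.MemLp v₀ 3 MeasureTheory.volume → Literature.Analysis.FluidPDE.IsWeaklyDivFree v₀ → MeasureTheory.eLpNorm (v₀ - u₀) 3 MeasureTheory.volume < ENNReal.ofReal ε → ∃ v : ℝ → EuclideanSpace ℝ (Fin 3) → EuclideanSpace ℝ (Fin 3), Literature.Analysis.FluidPDE.IsGlobalMildSolution 1 0 v₀ v ∧ Literature.Analysis.FluidPDE.ContinuousInLpOn (Set.Ici 0) 3 v ∧ v 0 = v₀ ∧ MeasureTheory.AEStronglyMeasurable (Function.uncurry v) (MeasureTheory.volume.restrict (Set.Ioi 0 ×ˢ Set.univ)) ∧ ∀ t : ℝ, 0 ≤ t → MeasureTheory.eLpNorm (v t - u t) 3 MeasureTheory.volume ≤ ENNReal.ofReal C * MeasureTheory.eLpNorm (v₀ - u₀) 3 MeasureTheory.volume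

-- `GIPL3Stability` holds: proved by `Summit.NavierStokesRegularity.NavierStokesRegularity.Theorems.amplitudeIndex_gipL3Stability_proof` (its module imports this route file, so no `_holds` link can be stated here).

-- earlier Assembly (stmt-NavierStokesRegularity-8417, replaced 2026-08-15T16:18:40Z -> stmt-NavierStokesRegularity-10566): retired by None — (∀ ν : ℝ, 0 < ν → ∀ u₀, (∀ ν' : ℝ, ν < ν' → Literature.Analysis.FluidPDE.HasGlobalKatoSolution ν' u₀) → ¬ Literature.Analysis.FluidPDE.HasGlobalKatoSolution ν u₀ → (∀ T u, 0 < T → Literature.Analysis.FluidPDE.IsKatoSolutionOn T ν u₀ u → ∀ x₀, ∃ r₀ : ℝ, 0 < r₀ ∧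
/-- item stmt-NavierStokesRegularity-10566 · assembly · rank 1 · closed · proved by Summit.NavierStokesRegularity.NavierStokesRegularity.Theorems.amplitudeIndex_assembly_proof (prover) · by planner
sources: Kato1984, AlbrittonBarker2019, Fefferman2000
[assembly] ThresholdEnstrophyStable → StableTangentFlowLiouville → MarginalBlowupTypeI →
GIPL3Stability → CriticalViscosityOfGIP → KatoToClay → NavierStokesRegularity, by decl names (rev 2;
the rev-1 item inlined the four original antecedents). Its proof IS the route's deciding theorem:
`theorem Assembly_holds : Assembly := closes` (closes is rendered in the route file, sorry-free,
axioms propext/Classical.choice/Quot.sound). [difficulty: provable-now] -/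
@[route_item "route-NavierStokesRegularity-AmplitudeIndex"]
def Assembly : Prop :=
  ThresholdEnstrophyStable → StableTangentFlowLiouville → MarginalBlowupTypeI → GIPL3Stability → CriticalViscosityOfGIP → KatoToClay → NavierStokesRegularity

-- `Assembly` holds: proved by `Summit.NavierStokesRegularity.NavierStokesRegularity.Theorems.amplitudeIndex_assembly_proof` (its module imports this route file, so no `_holds` link can be stated here).

/-! D-0027 §2.1 — DECIDING THEOREM (planner-authored via `route open/edit --closes-file`; by planner-rbadge-NavierStokesRegularity-Amplitud-4a8613be-g4-0 2026-08-15T16:18:40Z):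
its hypotheses are this route's items and its conclusion the sub-problem Statement (glue_lint), and it elaborates with this file. -/

@[closes "route-NavierStokesRegularity-AmplitudeIndex"] theorem closes (hT : ThresholdEnstrophyStable) (hS : StableTangentFlowLiouville)
    (hM : MarginalBlowupTypeI) (hGIP : GIPL3Stability) (hCV : CriticalViscosityOfGIP)
    (hKC : KatoToClay) : NavierStokesRegularity := by
  intro ν hν u₀ hsm hdiv hdec
  refine hKC ν hν u₀ hsm hdiv hdec ?_
  by_contra hnot
  obtain ⟨νc, hle, hnc, hglob⟩ := hCV hGIP ν hν u₀ hsm hdiv hdec hnot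
  have hνc : 0 < νc := lt_of_lt_of_le hν hle
  obtain ⟨v, hmild, hsmooth, hdecay, hstable, t, ht, x, hx⟩ :=
    hT νc hνc u₀ hsm hdiv hdec hglob hnc (hM νc hνc u₀ hsm hdiv hdec hglob hnc)
  exact hx (hS v hmild hsmooth hdecay hstable t ht x)

end Summit.NavierStokesRegularity.NavierStokesRegularity.Theses.AmplitudeIndex
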